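/-
Copyright: lit-balaban Phase-2 proof seat p02 (gen 4).  Statement-level skeleton of a published paper; no proof claims beyond
what the kernel checks below.
-/
import Literature.MathematicalPhysics.QuantumFieldTheory.BalabanImbrieJaffe1984to88.BIJ88Sect5StatementsPart4

/-!
# `BalabanImbrieJaffe1984to88.BIJ88Form5132LowerBound` — T. Bałaban, J. Imbrie, A. Jaffe, *Effective action and cluster
properties of the abelian Higgs model*, Commun. Math. Phys. **114** (1988) 257–315 [BalabanImbrieJaffe1988]: Sect. 5.13,
the sentence after **(5.13.2)** — *"This is still bounded below on the subspace determined by δ_Ax(A^{(k)″}): our lower bound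
on ∂*σ_{k,loc}∂ implies a lower bound ‖QA^{(k)″}‖² + O(1)‖A^{(k)″} − Q^{s*}QA^{(k)″}‖² ≥ O(1)‖A^{(k)″}‖²"* — PROVED as the
printed implication, with explicit constants, for the quadratic form of (5.13.2) on real inner-product spaces

statement-level skeleton of published theorems with citation tags; proofs where landed; nothing here is a claim about the Yang–Mills mass gap

PDF held: `paper:balaban1988-cmp114-bij-abelian-higgs-effective-action` (journal page = PDF page + 256; offloaded store file).
Page read as an image: PDF p. 48 (journal 304), render `run/shared/lean/pub/lit-balaban/lit-balaban-p02/pages/original-p048-x2.png`.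

CITATION HEADER (lean-in-tree rule).  Part of the lit-balaban TYPED SKELETON (HOME `run/shared/lean/pub/lit-balaban/`),
Phase-2 seat p02 (gen 4), row **C2.Eq5.13.1-5.13.2** of `HOME/SKELETON.md` (reader file `HOME/lit-balaban-r16/ROWS-C2-part2.md`),
its CLAIM part.  KNITTING of two landed pieces of the reader r16: `BIJ88Sect5StatementsPart4.form5132` (the operator of
(5.13.2), typed in a ring of operators) and `BIJ88Sect5Statements.claim304_lower` (the elementary last step
`‖A‖² ≤ 2M²‖QA‖² + 2‖A − Q^{s*}QA‖²`); companion of `BIJ88FictitiousField5131` ((5.13.1) and "integrating out B").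

THE PRINTED TEXT (p. 304 [PDF 48], verbatim).  *"Thus we have a new quadratic form for Λ₁₀^{(k)c*c}A^{(k)″}, namely
Q*Q + (I − Q*Q^s)∂*σ_{k,loc}∂(I − Q^{s*}Q). (5.13.2)  This is still bounded below on the subspace determined by δ_Ax(A^{(k)″}):
our lower bound on ∂*σ_{k,loc}∂ implies a lower bound  ‖QA^{(k)″}‖² + O(1)‖A^{(k)″} − Q^{s*}QA^{(k)″}‖² ≧ O(1)‖A^{(k)″}‖²."*

THE MODEL (the printed generality).  Real inner-product spaces `E` (gauge fields `A^{(k)″}` on the bonds of `Λ₁₀^{(k)c*c}`),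
`F` (block fields on the bonds of `Λ₁₀^{(k)′c*c}`), `P` (plaquette fields); bounded linear `Q, Q^s : E → F` (the linear and
the surface block averages), `∂ : E → P` (`d`), `σ = σ_{k,loc} : P → P`; `Q*`, `Q^{s*}`, `∂*` are the ADJOINTS
(`ContinuousLinearMap.adjoint`).  The operator of (5.13.2) is `op5132` below; *"the subspace determined by δ_Ax"* is a set
`W ⊆ E` (the axial configurations) and *"our lower bound on ∂*σ_{k,loc}∂"* is the displayed HYPOTHESIS
`c₀‖B‖² ≤ ⟨∂B, σ∂B⟩` on a set `W′ ∋ (I − Q^{s*}Q)A` for `A ∈ W` (in print: the axial configurations with `QB = 0`, where the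
bound comes from (2.19) `σ_{k,loc} ≧ c > 0` and the absence of zero modes of `∂` there, [BalabanImbrieJaffe1985] p. 309 —
the tree's `BIJ85NoZeroModes309Proof`); `‖Q^{s*}y‖ ≤ M‖y‖` is any operator bound (e.g. `M = ‖Q^s‖`, `op5132_lower_opNorm`).

WHAT IS KERNEL-CHECKED (zero `sorry`, standard axioms; Mathlib + the two cited tree declarations only).
* `inner_op5132` — `⟨A, (5.13.2)A⟩ = ‖QA‖² + ⟨∂(I − Q^{s*}Q)A, σ∂(I − Q^{s*}Q)A⟩` (adjoint bookkeeping: `(I − Q*Q^s)* = I − Q^{s*}Q`);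
* `inner_op5132_ge` — hence `⟨A, (5.13.2)A⟩ ≥ ‖QA‖² + c₀‖A − Q^{s*}QA‖²` on `W` (the printed left side, O(1) = c₀);
* **`op5132_lower`** — the printed conclusion with explicit constant:
  `⟨A, (5.13.2)A⟩ ≥ (min 1 c₀)/(2·max 1 M²) · ‖A‖²` for `A ∈ W` (via `claim304_lower`); `op5132_lower_opNorm` with `M = ‖Q^s‖`;
* `form5132_eq_op5132` — dictionary: in the one-space reading (all fields in one Hilbert space `H`, the ring `H →L[ℝ] H` of
  r16's typing) `BIJ88Sect5StatementsPart4.form5132 Q Q* Q^s Q^{s*} ∂* σ ∂ = op5132`.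
NOT here: the lower bound on `∂*σ_{k,loc}∂` itself (hypothesis), the identification with the Sect. 5 carriers, (5.12.8).
Unit `lit-balaban-p02` (literature-prover-lit-balaban-p02-g4-0), 2026-08-21.
-/

noncomputable section

open scoped InnerProduct RealInnerProductSpace

namespace Literature.MathematicalPhysics.QuantumFieldTheory.BalabanImbrieJaffe1984to88.BIJ88Form5132LowerBound

open ContinuousLinearMap

section ThreeSpaces

variable {E F P : Type*}
  [NormedAddCommGroup E] [InnerProductSpace ℝ E] [CompleteSpace E]
  [NormedAddCommGroup F] [InnerProductSpace ℝ F] [CompleteSpace F]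
  [NormedAddCommGroup P] [InnerProductSpace ℝ P] [CompleteSpace P]

/-- **(5.13.2)**, the operator `Q*Q + (I − Q*Q^s)∂*σ_{k,loc}∂(I − Q^{s*}Q)` on the gauge fields `A^{(k)″}` (adjoints w.r.t. the
`ℓ²` pairings). [cite: BalabanImbrieJaffe1988, (5.13.2) p.304] -/
def op5132 (Q Qs : E →L[ℝ] F) (d : E →L[ℝ] P) (σ : P →L[ℝ] P) : E →L[ℝ] E :=
  (Q†) ∘L Q + ((1 : E →L[ℝ] E) - (Q†) ∘L Qs) ∘L (d†) ∘L σ ∘L d ∘L ((1 : E →L[ℝ] E) - (Qs†) ∘L Q)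

/-- Pointwise form of (5.13.2): `(5.13.2)A = Q*QA + (I − Q*Q^s)∂*σ∂(A − Q^{s*}QA)`. [cite: BalabanImbrieJaffe1988, (5.13.2) p.304] -/
theorem op5132_apply (Q Qs : E →L[ℝ] F) (d : E →L[ℝ] P) (σ : P →L[ℝ] P) (A : E) :
    op5132 Q Qs d σ A =
      (Q†) (Q A) + ((d†) (σ (d (A - (Qs†) (Q A)))) - (Q†) (Qs ((d†) (σ (d (A - (Qs†) (Q A))))))) := by
  simp only [op5132, add_apply, comp_apply, sub_apply, one_apply_eq_self]

/-- **The quadratic form of (5.13.2)**: `⟨A, (5.13.2)A⟩ = ‖QA‖² + ⟨∂B, σ∂B⟩` with `B = (I − Q^{s*}Q)A` — since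
`⟨A, Q*QA⟩ = ‖QA‖²` and `(I − Q*Q^s)* = I − Q^{s*}Q`. [cite: BalabanImbrieJaffe1988, (5.13.2) p.304] -/
theorem inner_op5132 (Q Qs : E →L[ℝ] F) (d : E →L[ℝ] P) (σ : P →L[ℝ] P) (A : E) :
    ⟪A, op5132 Q Qs d σ A⟫ =
      ‖Q A‖ ^ 2 + ⟪d (A - (Qs†) (Q A)), σ (d (A - (Qs†) (Q A)))⟫ := by
  rw [op5132_apply, inner_add_right, inner_sub_right, adjoint_inner_right Q, adjoint_inner_right Q, ← adjoint_inner_left Qs,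
    ← inner_sub_left, adjoint_inner_right d, real_inner_self_eq_norm_sq]

/-- **"our lower bound on ∂*σ_{k,loc}∂ implies a lower bound ‖QA″‖² + O(1)‖A″ − Q^{s*}QA″‖²"**: if `c₀‖B‖² ≤ ⟨∂B, σ∂B⟩` on a
set `W′` containing `(I − Q^{s*}Q)A` for every `A` in `W` (the subspace determined by `δ_Ax`), then on `W`
`⟨A, (5.13.2)A⟩ ≥ ‖QA‖² + c₀‖A − Q^{s*}QA‖²`. [cite: BalabanImbrieJaffe1988, (5.13.2) p.304] -/
theorem inner_op5132_ge (Q Qs : E →L[ℝ] F) (d : E →L[ℝ] P) (σ : P →L[ℝ] P) {W W' : Set E} {c₀ : ℝ}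
    (hσ : ∀ B ∈ W', c₀ * ‖B‖ ^ 2 ≤ ⟪d B, σ (d B)⟫) (hW : ∀ A ∈ W, A - (Qs†) (Q A) ∈ W') {A : E} (hA : A ∈ W) :
    ‖Q A‖ ^ 2 + c₀ * ‖A - (Qs†) (Q A)‖ ^ 2 ≤ ⟪A, op5132 Q Qs d σ A⟫ := by
  rw [inner_op5132]
  exact add_le_add le_rfl (hσ _ (hW A hA))

/-- **The printed conclusion, explicit**: under the same hypotheses and an operator bound `‖Q^{s*}y‖ ≤ M‖y‖`, for `A ∈ W`
`⟨A, (5.13.2)A⟩ ≥ (min 1 c₀)/(2 max 1 M²) · ‖A‖²` — i.e. *"≧ O(1)‖A^{(k)″}‖²"*, the last step being the reader's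
`BIJ88Sect5Statements.claim304_lower` (`‖A‖² ≤ 2M²‖QA‖² + 2‖A − Q^{s*}QA‖²`). [cite: BalabanImbrieJaffe1988, (5.13.2) p.304] -/
theorem op5132_lower (Q Qs : E →L[ℝ] F) (d : E →L[ℝ] P) (σ : P →L[ℝ] P) {W W' : Set E} {c₀ M : ℝ} (hc₀ : 0 ≤ c₀)
    (hσ : ∀ B ∈ W', c₀ * ‖B‖ ^ 2 ≤ ⟪d B, σ (d B)⟫) (hW : ∀ A ∈ W, A - (Qs†) (Q A) ∈ W')
    (hM : ∀ y, ‖(Qs†) y‖ ≤ M * ‖y‖) {A : E} (hA : A ∈ W) :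
    min 1 c₀ / (2 * max 1 (M ^ 2)) * ‖A‖ ^ 2 ≤ ⟪A, op5132 Q Qs d σ A⟫ := by
  have h304 := BIJ88Sect5Statements.claim304_lower Q (Qs†) hM A
  have hge := inner_op5132_ge Q Qs d σ hσ hW hA
  set x := ‖Q A‖ ^ 2 with hx
  set y := ‖A - (Qs†) (Q A)‖ ^ 2 with hy
  have hx0 : 0 ≤ x := by positivity
  have hy0 : 0 ≤ y := by positivity
  have hm1 : min 1 c₀ ≤ 1 := min_le_left _ _
  have hmc : min 1 c₀ ≤ c₀ := min_le_right _ _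
  have hm0 : 0 ≤ min 1 c₀ := le_min zero_le_one hc₀
  have hμ1 : (1 : ℝ) ≤ max 1 (M ^ 2) := le_max_left _ _
  have hμM : M ^ 2 ≤ max 1 (M ^ 2) := le_max_right _ _
  have hμ0 : 0 < 2 * max 1 (M ^ 2) := by positivity
  -- `‖A‖² ≤ 2M²x + 2y ≤ 2μ(x + y)` and `⟨A,TA⟩ ≥ x + c₀y ≥ m(x + y)`
  have hA2 : ‖A‖ ^ 2 ≤ 2 * max 1 (M ^ 2) * (x + y) := by
    calc ‖A‖ ^ 2 ≤ 2 * M ^ 2 * x + 2 * y := h304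
      _ ≤ 2 * max 1 (M ^ 2) * x + 2 * max 1 (M ^ 2) * y := by
          apply add_le_add
          · exact mul_le_mul_of_nonneg_right (by linarith) hx0
          · exact mul_le_mul_of_nonneg_right (by linarith) hy0
      _ = 2 * max 1 (M ^ 2) * (x + y) := by ring
  have hT : min 1 c₀ * (x + y) ≤ ⟪A, op5132 Q Qs d σ A⟫ := by
    calc min 1 c₀ * (x + y) = min 1 c₀ * x + min 1 c₀ * y := by ring
      _ ≤ 1 * x + c₀ * y := add_le_add (mul_le_mul_of_nonneg_right hm1 hx0) (mul_le_mul_of_nonneg_right hmc hy0)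
      _ = x + c₀ * y := by ring
      _ ≤ ⟪A, op5132 Q Qs d σ A⟫ := hge
  calc min 1 c₀ / (2 * max 1 (M ^ 2)) * ‖A‖ ^ 2
      ≤ min 1 c₀ / (2 * max 1 (M ^ 2)) * (2 * max 1 (M ^ 2) * (x + y)) :=
        mul_le_mul_of_nonneg_left hA2 (div_nonneg hm0 hμ0.le)
    _ = min 1 c₀ * (x + y) := by field_simp
    _ ≤ ⟪A, op5132 Q Qs d σ A⟫ := hT

/-- The same with the canonical bound `M = ‖Q^s‖` (`‖Q^{s*}‖ = ‖Q^s‖`): `⟨A, (5.13.2)A⟩ ≥ (min 1 c₀)/(2 max 1 ‖Q^s‖²) · ‖A‖²` on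
`W`. [cite: BalabanImbrieJaffe1988, (5.13.2) p.304] -/
theorem op5132_lower_opNorm (Q Qs : E →L[ℝ] F) (d : E →L[ℝ] P) (σ : P →L[ℝ] P) {W W' : Set E} {c₀ : ℝ} (hc₀ : 0 ≤ c₀)
    (hσ : ∀ B ∈ W', c₀ * ‖B‖ ^ 2 ≤ ⟪d B, σ (d B)⟫) (hW : ∀ A ∈ W, A - (Qs†) (Q A) ∈ W') {A : E} (hA : A ∈ W) :
    min 1 c₀ / (2 * max 1 (‖Qs‖ ^ 2)) * ‖A‖ ^ 2 ≤ ⟪A, op5132 Q Qs d σ A⟫ := by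
  refine op5132_lower Q Qs d σ hc₀ hσ hW (fun y => ?_) hA
  calc ‖(Qs†) y‖ ≤ ‖Qs†‖ * ‖y‖ := le_opNorm _ _
    _ = ‖Qs‖ * ‖y‖ := by rw [LinearIsometryEquiv.norm_map]

end ThreeSpaces

/-! ## Dictionary with the reader's ring-level typing of (5.13.2) -/

section OneSpace

variable {H : Type*} [NormedAddCommGroup H] [InnerProductSpace ℝ H] [CompleteSpace H]

/-- In the one-space reading of r16's `form5132` (all fields in one Hilbert space `H`, the ring of operators `H →L[ℝ] H`,
`Q*`/`Q^{s*}`/`∂*` the adjoints): `form5132 Q Q* Q^s Q^{s*} ∂* σ ∂ = op5132 Q Q^s ∂ σ`. [cite: BalabanImbrieJaffe1988, (5.13.2) p.304] -/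
theorem form5132_eq_op5132 (Q Qs d σ : H →L[ℝ] H) :
    BIJ88Sect5StatementsPart4.form5132 Q (Q†) Qs (Qs†) (d†) σ d = op5132 Q Qs d σ := by
  simp only [BIJ88Sect5StatementsPart4.form5132, op5132, ContinuousLinearMap.mul_def]
  rfl

/-- Hence the printed lower bound for the reader's `form5132` in the one-space reading. [cite: BalabanImbrieJaffe1988, (5.13.2) p.304] -/
theorem form5132_lower (Q Qs d σ : H →L[ℝ] H) {W W' : Set H} {c₀ M : ℝ} (hc₀ : 0 ≤ c₀)
    (hσ : ∀ B ∈ W', c₀ * ‖B‖ ^ 2 ≤ ⟪d B, σ (d B)⟫) (hW : ∀ A ∈ W, A - (Qs†) (Q A) ∈ W')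
    (hM : ∀ y, ‖(Qs†) y‖ ≤ M * ‖y‖) {A : H} (hA : A ∈ W) :
    min 1 c₀ / (2 * max 1 (M ^ 2)) * ‖A‖ ^ 2 ≤ ⟪A, BIJ88Sect5StatementsPart4.form5132 Q (Q†) Qs (Qs†) (d†) σ d A⟫ := by
  rw [form5132_eq_op5132]
  exact op5132_lower Q Qs d σ hc₀ hσ hW hM hA

end OneSpace

end Literature.MathematicalPhysics.QuantumFieldTheory.BalabanImbrieJaffe1984to88.BIJ88Form5132LowerBound

end
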